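import Summits.QuantumFields.BalabanUV.Beta.FP.PerfectObjectsT
import Summits.QuantumFields.BalabanUV.Beta.HessKerFourFamily
import Summits.QuantumFields.BalabanUV.Beta.AxialDressingRootedBmHessian

/-!
# `BalabanUV.Beta.FP.RoadEndGeneric` — road «FP» for binder row D1: THE ROAD's END BY TYPE RE-POSED DRESSING-AGNOSTICALLY
# (owner ruling R-FP-13): generic perfect objects `KPerfOf` / `TGenOf` / `fPerfG` over ANY supplied (j, m)-families in FOUR slots, and
# (CONV-C-Cauchy) rows + (STEP) + (ASYMP) ⊢ `D1Drift Lc Js N μ ν` for EVERY wall family `Js` admitting a four-family closed form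
# `TbalOf Lc Js j = hessKer (A j) (vertexOfK (K j) Lc (S j)) (W j)` — comb (route (α)), block-mean rooted (v2.23/v2.26 candidates) and the
# DIRECT form (any `Js` whatsoever) are instances (§3–§4)

HONEST FRAMING (cell contract, verbatim): «discharging `BetaPertH` makes Bałaban's UV stability UNCONDITIONAL — a real constructive-QFT
result; it is NOT the continuum limit and NOT the Clay problem.»  THIS MODULE DISCHARGES NOTHING: it is `FP/RoadEnd` + `FP/PerfectObjectsT` §2
with asym1's dressing-specific END `HessKerDressedUnitsWall.d1Drift_JsBalOf_of_lim_eq_unit` replaced by asym1's FOUR-FAMILY END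
`HessKerFourFamily.d1Drift_iff_of_cauchy_four` (any jet data with a closed form; rows on the four unit-rescaled families; constructed limits).
WHY (owner ruling R-FP-13, answering leaf-01-g5's located finding «N3-FINE-DRESSING-MISMATCH», journal l.15863): road FP's END of record
(`FP/RoadWardExplicit`, pinned COMB-dressed family `JsBalT2Of …`) and its REP∞ chain name the corner-comb dressing `axDressK`/`coProj`, while
every finite-`j` Ward / relative-inverse LETTER in the tree is typed for the block-mean rooted dressing `coDressKBmAt`/`coProjBmAtK`; the wall
literal of record is the β-leads' (R45) ruling (v2.21 comb `JsBalAn1`; candidates v2.23/v2.26 block-mean).  Road FP's composition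
((RATE)+(STEP)+(ASYMP) ⇒ `D1Drift`, `FixedPointIdentification`) never used the dressing; here it is stated ONCE for all of them, so that the
road's two hypotheses (STEP)/(ASYMP) are properties of the perfect coefficient family `fPerfG` of WHICHEVER literal the leads pick, and the
letter suppliers are consumed in the dressing in which they exist.  Every analytic statement stays a HYPOTHESIS ((CONV-C-Cauchy) rows = row
G-an2-4; (STEP) = leaf N2/N6 — β-additivity of the perfect polarizations; (ASYMP) = leaf N7).  Skeleton `HOME/beta/skeletons/D1-b2b-balaban-beta-d1-p3.md`;
claim table `HOME/b2b-balaban-beta-d1-p3/LEAVES-FP.md` (row END-GENERIC).  NOT «D1 closed», NOT BetaPertH, NOT continuum, NOT Clay.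
ABSOLUTE RULE (cell, verbatim): «No internally-minted statement may enter as a cited fact. Every hypothesis is either kernel-proved in this
package or a verbatim quotation of a PUBLISHED theorem with page reference.»  Nothing is cited; no `def … : Prop`; no binder instantiated at a value.
HONEST DEPENDENCY (verbatim): «continuum YM on T⁴ ⇐ BetaPertH ∧ nine spine estimates (0/9 proved); BetaPertH ⇐ (D1) ∧ (D4) ∧ CAP+tail;
G-an2-4 gates asym, D1 and NE2/3/4.»

CONTENT.
* §1 [our objects] `KPerfOf sf sm G m := limMKerOf (j ↦ unitK (sf j) (sm j) (G j m))` (the perfect `m`-fold resolvent of ANY supplied (j, m)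
  resolvent family; `KPerf_eq_KPerfOf`: road FP's `KPerf` is the instance `G j m := KTot (Lc^(j+m)) (Lc^j)`), `TGenOf n A K S W := hessKer A
  (vertexOfK K n S) W` (the four-slot one-step polarization kernel — the shape of EVERY wall member, `HessKerFourFamily.TbalOf_apply`), `fPerfG`
  (its (1.22) coefficient along the perfect (j, m)-limits), `fPerfG_one` (the `m = 1` value IS the second moment of road A2's four-family limit
  kernel), `TPerfOf_eq_TGenOf` (road FP's comb kernel is the instance `(Π K Π, K, Πᵀ S, W)`, `AxialDressing.vertexOfK_coProj_eq`).
* §2 **`d1Drift_of_generic_step_law_bounded`** / **`_littleO`**: ANY `Js` with a closed form `hT`, Cauchy-currency rows on the unit-rescaled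
  `m = 1` families, (STEP) + (ASYMP) for `fPerfG` ⊢ `D1Drift Lc Js N μ ν`; `endpointExistence_of_generic_step_law_bounded` (the cell's END
  statement from it, `OneStepKernelFamily.endpointExistence_of_D1Drift`).
* §3 **`d1Drift_of_self_step_law_bounded`**: the DIRECT instance — ANY `Js : ℕ → JetData 3 Lc` (any dressing, any root), closed form by `rfl`
  (`K_j = KInvStep Lc j`, the jet data's OWN stencils and tables).
* §4 **`d1Drift_dressBmAt_of_step_law_bounded`**: the BLOCK-MEAN ROOTED instance `Js = dressBmAt hr ∘ Js⁰` (an2's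
  `AxialDressingRootedBmHessian.TbalOf_dressBmAt`: `G_j = coDressKBmAt (toSite r) Lc (KInvStep Lc j)`, UNDRESSED jets) — the shape of the row's
  v2.23/v2.26 candidates, in which every finite-`j` letter of the tree is typed.
Provenance: road FP owner b2b-balaban-beta-d1-p3 gen 3, 2026-08-20; composition over asym1's `HessKerFourFamily`, an2's
`AxialDressingRootedBmHessian`, road FP's `PerfectObjectsT`/`RoadEnd` BY NAME; no existing file touched.  [our object], 0 cite, 0 sorry.
-/

namespace Summit.QuantumFields.BalabanUV.Beta.FP.RoadEndGeneric

open Filter Topology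
open Literature.MathematicalPhysics.QuantumFieldTheory.Balaban1983to89
open Literature.MathematicalPhysics.QuantumFieldTheory.Balaban1983to89.Beta
open FlowStep FlowStepRuns DagBinding
open ExpKernelCalculus (MKer Decays VertexFamily₂ hessKer)
open OneStepResolventKernel (Fib LocStencil JetData)
open OneStepKernelFamily (vertexOfK KInvStep TbalOf D1Drift endpointExistence_of_D1Drift)
open AffineAveraging (box toSite)
open AxialProjector (coProj)
open AxialDressing (axDressK axVertexOfK vertexOfK_coProj_eq)
open B12Normalization (stepBal)
open Literature.MathematicalPhysics.QuantumFieldTheory.Balaban1983to89.Beta.RemainderChain (RemainderConst)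
open HessKerDressedLimit (limMKerOf limStOf limTabOf)
open Summit.QuantumFields.BalabanUV.Beta.HessKerDressedUnits (unitK unitS unitW)
open Summit.QuantumFields.BalabanUV.Beta.HessKerFourFamily (hessKer_four_unit d1Drift_iff_of_cauchy_four TbalOf_apply)
open Summit.QuantumFields.BalabanUV.Beta.AxialDressingRooted (dressBmAt coDressKBmAt TbalOf_dressBmAt)
open Summit.QuantumFields.BalabanUV.Beta.FP.PerfectObjects (KTot)
open Summit.QuantumFields.BalabanUV.Beta.FP.PerfectObjectsT (KPerf SPerfOf WPerfOf TPerfOf fPerf SPerfOf_one WPerfOf_one)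
open Summit.QuantumFields.BalabanUV.Beta.FP.RoadEnd (value_eq_of_step_law_bounded' value_eq_of_step_law_littleO')

noncomputable section

/-! ## §1 The generic perfect objects -/

section Objects

variable {d : ℕ}

/-- [our object] **THE PERFECT `m`-FOLD RESOLVENT OF A SUPPLIED (j, m) RESOLVENT FAMILY** in units `(sf, sm)`: the constructed entrywise
limit, as `j → ∞`, of `unitK (sf j) (sm j) (G j m)` — for ANY family `G` (undressed `KTot`, comb-dressed, block-mean co-dressed, …). -/
def KPerfOf (sf sm : ℕ → ℝ) (G : ℕ → ℕ → MKer (d + 1) (Fib d)) (m : ℕ) : MKer (d + 1) (Fib d) :=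
  limMKerOf fun j => unitK (sf j) (sm j) (G j m)

/-- [our object] `m = 1` with a named member family: `KPerfOf … 1` is road A2's constructed limit of that family. -/
theorem KPerfOf_one (sf sm : ℕ → ℝ) {G : ℕ → ℕ → MKer (d + 1) (Fib d)} {G1 : ℕ → MKer (d + 1) (Fib d)} (hG1 : ∀ j, G j 1 = G1 j) :
    KPerfOf sf sm G 1 = limMKerOf fun j => unitK (sf j) (sm j) (G1 j) := by
  unfold KPerfOf; simp only [hG1]

/-- [our object] Road FP's `KPerf` (the undressed (j, m)-resolvents `KTot (Lc^(j+m)) (Lc^j)`) is the instance `G j m := KTot (Lc^(j+m)) (Lc^j)`, by `rfl`. -/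
theorem KPerf_eq_KPerfOf (Lc : ℕ) [NeZero Lc] (sf sm : ℕ → ℝ) (m : ℕ) :
    KPerf (d := d) Lc sf sm m = KPerfOf sf sm (fun j m => KTot (d := d) (Lc ^ (j + m)) (Lc ^ j)) m := rfl

end Objects

/-- [our object] **THE FOUR-SLOT ONE-STEP POLARIZATION KERNEL** with blocking `n` (dimension four): `hessKer A (vertexOfK K n S) W` — A-slot legs
`A`, chain-rule vertex through the `ℋ`-column of `K` with stencils `S`, tables `W`.  EVERY member of EVERY wall family is of this shape
(`HessKerFourFamily.TbalOf_apply`: `(KInvStep, KInvStep, (Js j).S, (Js j).W)`; comb: `(Π K Π, K, Πᵀ S, W)`; block-mean: `(G, G, S, W)`). -/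
def TGenOf (n : ℕ) (A K : MKer (3 + 1) (Fib 3)) (S : Fin (3 + 1) → (Fin (3 + 1) → ℤ) → MKer (3 + 1) (Fib 3))
    (W : Fin (3 + 1) → (Fin (3 + 1) → ℤ) → Fin (3 + 1) → (Fin (3 + 1) → ℤ) → MKer (3 + 1) (Fib 3)) :
    Fin (3 + 1) → Fin (3 + 1) → (Fin (3 + 1) → ℤ) → ℝ :=
  hessKer A (vertexOfK K n S) W

/-- [our object] **ROAD FP's COMB KERNEL IS A FOUR-SLOT INSTANCE**: `TPerfOf n K S W = TGenOf n (Π K Π) K (Πᵀ S) W` for a decaying `K` and a local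
stencil family (`AxialDressing.vertexOfK_coProj_eq`, entrywise adjunction). -/
theorem TPerfOf_eq_TGenOf {n : ℕ} (hn : 1 ≤ n) {K : MKer (3 + 1) (Fib 3)} {C δ : ℝ} (hK : Decays K C δ) (hδ : 0 < δ)
    {S : Fin (3 + 1) → (Fin (3 + 1) → ℤ) → MKer (3 + 1) (Fib 3)} {Cs δs : ℝ} (hS : LocStencil S Cs δs) (hδs : 0 ≤ δs)
    (W : Fin (3 + 1) → (Fin (3 + 1) → ℤ) → Fin (3 + 1) → (Fin (3 + 1) → ℤ) → MKer (3 + 1) (Fib 3)) :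
    TPerfOf n K S W = TGenOf n (axDressK n K) K (coProj n S) W := by
  unfold TPerfOf TGenOf
  have e : axVertexOfK K n S = vertexOfK K n (coProj n S) :=
    funext fun μ => funext fun y => (vertexOfK_coProj_eq hn hK hδ hS hδs μ y).symm
  rw [e]

section Coefficient

variable (Lc : ℕ) (sf sm : ℕ → ℝ) (A G : ℕ → ℕ → MKer (3 + 1) (Fib 3))
  (S : ℕ → ℕ → Fin (3 + 1) → (Fin (3 + 1) → ℤ) → MKer (3 + 1) (Fib 3))
  (Wt : ℕ → ℕ → Fin (3 + 1) → (Fin (3 + 1) → ℤ) → Fin (3 + 1) → (Fin (3 + 1) → ℤ) → MKer (3 + 1) (Fib 3))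
  (μ ν : Fin 4)

/-- [our object] **THE GENERIC PERFECT COEFFICIENT FAMILY** `m ↦ fPerfG … m`: the (1.22) second moment, channel `(μ, ν)`, of the four-slot kernel
with blocking `Lc^m` at the perfect `m`-fold objects (READING, header only: the one-loop polarization of the perfect `m`-fold step = ONE perfect step
with blocking `Lc^m`, leaf N1). -/
def fPerfG (m : ℕ) : ℝ :=
  B12Beta.secondMoment
    (TGenOf (Lc ^ m) (KPerfOf sf sm A m) (KPerfOf sf sm G m) (SPerfOf sf sm S m) (WPerfOf sf sm Wt m)) μ ν

/-- [our object] Unfolding of `fPerfG`. -/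
theorem fPerfG_def (m : ℕ) : fPerfG Lc sf sm A G S Wt μ ν m =
    B12Beta.secondMoment (hessKer (KPerfOf sf sm A m) (vertexOfK (KPerfOf sf sm G m) (Lc ^ m) (SPerfOf sf sm S m))
      (WPerfOf sf sm Wt m)) μ ν := rfl

/-- [our object] **`m = 1` IS ROAD A2's FOUR-FAMILY LIMIT VALUE**: with the `m = 1` members named `(A1, G1, S1, W1)`,
`fPerfG … 1 = secondMoment (hessKer (limMKerOf (unitK ∘ A1)) (vertexOfK (limMKerOf (unitK ∘ G1)) Lc (limStOf (unitS ∘ S1))) (limTabOf (unitW ∘ W1))) μ ν`. -/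
theorem fPerfG_one {A1 G1 : ℕ → MKer (3 + 1) (Fib 3)} {S1 : ℕ → Fin (3 + 1) → (Fin (3 + 1) → ℤ) → MKer (3 + 1) (Fib 3)}
    {W1 : ℕ → Fin (3 + 1) → (Fin (3 + 1) → ℤ) → Fin (3 + 1) → (Fin (3 + 1) → ℤ) → MKer (3 + 1) (Fib 3)}
    (hA1 : ∀ j, A j 1 = A1 j) (hG1 : ∀ j, G j 1 = G1 j) (hS1 : ∀ j, S j 1 = S1 j) (hW1 : ∀ j, Wt j 1 = W1 j) :
    fPerfG Lc sf sm A G S Wt μ ν 1 =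
      B12Beta.secondMoment (hessKer (limMKerOf fun j => unitK (sf j) (sm j) (A1 j))
        (vertexOfK (limMKerOf fun j => unitK (sf j) (sm j) (G1 j)) Lc (limStOf fun j => unitS (sf j) (sm j) (S1 j)))
        (limTabOf fun j => unitW (sf j) (sm j) (W1 j))) μ ν := by
  rw [fPerfG_def, pow_one, KPerfOf_one sf sm hA1, KPerfOf_one sf sm hG1, SPerfOf_one sf sm hS1, WPerfOf_one sf sm hW1]

end Coefficient

/-! ## §2 ROAD FP's END FOR ANY WALL FAMILY WITH A FOUR-FAMILY CLOSED FORM -/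

section End

variable {Lc : ℕ} [NeZero Lc] (Js : ℕ → JetData 3 Lc) (sf sm : ℕ → ℝ) (A G : ℕ → ℕ → MKer (3 + 1) (Fib 3))
  (S : ℕ → ℕ → Fin (3 + 1) → (Fin (3 + 1) → ℤ) → MKer (3 + 1) (Fib 3))
  (Wt : ℕ → ℕ → Fin (3 + 1) → (Fin (3 + 1) → ℤ) → Fin (3 + 1) → (Fin (3 + 1) → ℤ) → MKer (3 + 1) (Fib 3))
  {A1 G1 : ℕ → MKer (3 + 1) (Fib 3)} {S1 : ℕ → Fin (3 + 1) → (Fin (3 + 1) → ℤ) → MKer (3 + 1) (Fib 3)}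
  {W1 : ℕ → Fin (3 + 1) → (Fin (3 + 1) → ℤ) → Fin (3 + 1) → (Fin (3 + 1) → ℤ) → MKer (3 + 1) (Fib 3)}
  {R CA cA C cK δK Cs cS δS Cw cW δW θ : ℝ}

/-- [our object] The closed form in unit currency: units invariance of the four-slot kernel (`HessKerFourFamily.hessKer_four_unit`). -/
theorem closedForm_unit (hsf : ∀ j, sf j ≠ 0) (hsm : ∀ j, sm j ≠ 0)
    (hT : ∀ j, TbalOf Lc Js j = hessKer (A1 j) (vertexOfK (G1 j) Lc (S1 j)) (W1 j)) (j : ℕ) :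
    TbalOf Lc Js j = hessKer (unitK (sf j) (sm j) (A1 j))
      (vertexOfK (unitK (sf j) (sm j) (G1 j)) Lc (unitS (sf j) (sm j) (S1 j))) (unitW (sf j) (sm j) (W1 j)) := by
  rw [hT j]
  exact (hessKer_four_unit (hsf j) (hsm j) Lc (A1 j) (G1 j) (S1 j) (W1 j)).symm

/-- **ROAD «FP», THE END BY TYPE, DRESSING-AGNOSTIC (bounded-defect form).**  For ANY step jet data `Js : ℕ → JetData 3 Lc` whose wall kernels
admit a four-family closed form `hT` (members `(A1, G1, S1, W1)`), ANY (j, m)-families `(A, G, S, Wt)` whose `m = 1` members are those, and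
nonzero unit sequences: IF the Cauchy-currency (CONV-C-Cauchy) rows hold for the four unit-rescaled `m = 1` families (row G-an2-4 for the
resolvent slots; stencil/table rows — HYPOTHESES), AND the generic perfect coefficient family satisfies the STEP LAW `fPerfG (m+1) = fPerfG m + fPerfG 1`
(leaf N2/N6) and the LEADING-LOG ASYMPTOTICS `|fPerfG m − m·stepBal N Lc| ≤ Cg` (leaf N7), THEN `D1Drift Lc Js N μ ν`.  The identification
`secondMoment T∞ μ ν = stepBal N Lc` is DERIVED (`RoadEnd.value_eq_of_step_law_bounded'`), then asym1's `HessKerFourFamily.d1Drift_iff_of_cauchy_four`.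
Discharges nothing by itself. -/
theorem d1Drift_of_generic_step_law_bounded (hsf : ∀ j, sf j ≠ 0) (hsm : ∀ j, sm j ≠ 0)
    (hT : ∀ j, TbalOf Lc Js j = hessKer (A1 j) (vertexOfK (G1 j) Lc (S1 j)) (W1 j))
    (hA1 : ∀ j, A j 1 = A1 j) (hG1 : ∀ j, G j 1 = G1 j) (hS1 : ∀ j, S j 1 = S1 j) (hW1 : ∀ j, Wt j 1 = W1 j)
    (hA : ∀ j, Decays (unitK (sf j) (sm j) (A1 j)) CA δK)
    (hAall : ∀ k j, Decays (unitK (sf (k + j)) (sm (k + j)) (A1 (k + j)) - unitK (sf k) (sm k) (A1 k)) (cA * θ ^ k) δK)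
    (hK : ∀ j, Decays (unitK (sf j) (sm j) (G1 j)) C δK)
    (hKall : ∀ k j, Decays (unitK (sf (k + j)) (sm (k + j)) (G1 (k + j)) - unitK (sf k) (sm k) (G1 k)) (cK * θ ^ k) δK)
    (hS : ∀ j, LocStencil (unitS (sf j) (sm j) (S1 j)) Cs δS)
    (hSall : ∀ k j, LocStencil (unitS (sf (k + j)) (sm (k + j)) (S1 (k + j)) - unitS (sf k) (sm k) (S1 k)) (cS * θ ^ k) δS)
    (hW : ∀ j, VertexFamily₂ (unitW (sf j) (sm j) (W1 j)) Lc Cw δW)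
    (hWall : ∀ k j, VertexFamily₂ (unitW (sf (k + j)) (sm (k + j)) (W1 (k + j)) - unitW (sf k) (sm k) (W1 k)) Lc (cW * θ ^ k) δW)
    (hR : 0 < R) (hRK : R < δK) (hRS : R / 2 < δS) (hRW : R < δW) (hθ0 : 0 ≤ θ) (hθ1 : θ < 1) (μ ν : Fin 4) {N Cg : ℝ}
    (hstep : ∀ m : ℕ, 1 ≤ m →
      fPerfG Lc sf sm A G S Wt μ ν (m + 1) = fPerfG Lc sf sm A G S Wt μ ν m + fPerfG Lc sf sm A G S Wt μ ν 1)
    (hasym : ∀ m : ℕ, 1 ≤ m → |fPerfG Lc sf sm A G S Wt μ ν m - (m : ℝ) * stepBal N Lc| ≤ Cg) :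
    D1Drift Lc Js N μ ν := by
  have h1 := value_eq_of_step_law_bounded' hstep hasym
  rw [fPerfG_one Lc sf sm A G S Wt μ ν hA1 hG1 hS1 hW1] at h1
  exact (d1Drift_iff_of_cauchy_four Js (closedForm_unit Js sf sm hsf hsm hT) hA hAall hK hKall hS hSall hW hWall hR hRK hRS hRW
    hθ0 hθ1 μ ν N).mpr h1

/-- **ROAD «FP», THE END BY TYPE, DRESSING-AGNOSTIC (mean-law form)**: the asymptotic input weakened to `(fPerfG m − m·stepBal N Lc)/m → 0`. -/
theorem d1Drift_of_generic_step_law_littleO (hsf : ∀ j, sf j ≠ 0) (hsm : ∀ j, sm j ≠ 0)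
    (hT : ∀ j, TbalOf Lc Js j = hessKer (A1 j) (vertexOfK (G1 j) Lc (S1 j)) (W1 j))
    (hA1 : ∀ j, A j 1 = A1 j) (hG1 : ∀ j, G j 1 = G1 j) (hS1 : ∀ j, S j 1 = S1 j) (hW1 : ∀ j, Wt j 1 = W1 j)
    (hA : ∀ j, Decays (unitK (sf j) (sm j) (A1 j)) CA δK)
    (hAall : ∀ k j, Decays (unitK (sf (k + j)) (sm (k + j)) (A1 (k + j)) - unitK (sf k) (sm k) (A1 k)) (cA * θ ^ k) δK)
    (hK : ∀ j, Decays (unitK (sf j) (sm j) (G1 j)) C δK)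
    (hKall : ∀ k j, Decays (unitK (sf (k + j)) (sm (k + j)) (G1 (k + j)) - unitK (sf k) (sm k) (G1 k)) (cK * θ ^ k) δK)
    (hS : ∀ j, LocStencil (unitS (sf j) (sm j) (S1 j)) Cs δS)
    (hSall : ∀ k j, LocStencil (unitS (sf (k + j)) (sm (k + j)) (S1 (k + j)) - unitS (sf k) (sm k) (S1 k)) (cS * θ ^ k) δS)
    (hW : ∀ j, VertexFamily₂ (unitW (sf j) (sm j) (W1 j)) Lc Cw δW)
    (hWall : ∀ k j, VertexFamily₂ (unitW (sf (k + j)) (sm (k + j)) (W1 (k + j)) - unitW (sf k) (sm k) (W1 k)) Lc (cW * θ ^ k) δW)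
    (hR : 0 < R) (hRK : R < δK) (hRS : R / 2 < δS) (hRW : R < δW) (hθ0 : 0 ≤ θ) (hθ1 : θ < 1) (μ ν : Fin 4) {N : ℝ}
    (hstep : ∀ m : ℕ, 1 ≤ m →
      fPerfG Lc sf sm A G S Wt μ ν (m + 1) = fPerfG Lc sf sm A G S Wt μ ν m + fPerfG Lc sf sm A G S Wt μ ν 1)
    (hasym : Tendsto (fun m : ℕ => (fPerfG Lc sf sm A G S Wt μ ν m - (m : ℝ) * stepBal N Lc) / (m : ℝ)) atTop (𝓝 0)) :
    D1Drift Lc Js N μ ν := by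
  have h1 := value_eq_of_step_law_littleO' hstep hasym
  rw [fPerfG_one Lc sf sm A G S Wt μ ν hA1 hG1 hS1 hW1] at h1
  exact (d1Drift_iff_of_cauchy_four Js (closedForm_unit Js sf sm hsf hsm hT) hA hAall hK hKall hS hSall hW hWall hR hRK hRS hRW
    hθ0 hθ1 μ ν N).mpr h1

/-- **THE CELL's END STATEMENT FROM ROAD «FP», DRESSING-AGNOSTIC**: `EndpointExistence Cn` BY TYPE from §2's hypotheses + `hβ` (the one-loop
split IS this family's second moments) + (D4) `RemainderConst` with `rr ≤ stepBal` + (C) + `hgen` (`OneStepKernelFamily.endpointExistence_of_D1Drift`).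
NOT the continuum limit's construction. -/
theorem endpointExistence_of_generic_step_law_bounded (hsf : ∀ j, sf j ≠ 0) (hsm : ∀ j, sm j ≠ 0)
    (hT : ∀ j, TbalOf Lc Js j = hessKer (A1 j) (vertexOfK (G1 j) Lc (S1 j)) (W1 j))
    (hA1 : ∀ j, A j 1 = A1 j) (hG1 : ∀ j, G j 1 = G1 j) (hS1 : ∀ j, S j 1 = S1 j) (hW1 : ∀ j, Wt j 1 = W1 j)
    (hA : ∀ j, Decays (unitK (sf j) (sm j) (A1 j)) CA δK)
    (hAall : ∀ k j, Decays (unitK (sf (k + j)) (sm (k + j)) (A1 (k + j)) - unitK (sf k) (sm k) (A1 k)) (cA * θ ^ k) δK)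
    (hK : ∀ j, Decays (unitK (sf j) (sm j) (G1 j)) C δK)
    (hKall : ∀ k j, Decays (unitK (sf (k + j)) (sm (k + j)) (G1 (k + j)) - unitK (sf k) (sm k) (G1 k)) (cK * θ ^ k) δK)
    (hS : ∀ j, LocStencil (unitS (sf j) (sm j) (S1 j)) Cs δS)
    (hSall : ∀ k j, LocStencil (unitS (sf (k + j)) (sm (k + j)) (S1 (k + j)) - unitS (sf k) (sm k) (S1 k)) (cS * θ ^ k) δS)
    (hW : ∀ j, VertexFamily₂ (unitW (sf j) (sm j) (W1 j)) Lc Cw δW)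
    (hWall : ∀ k j, VertexFamily₂ (unitW (sf (k + j)) (sm (k + j)) (W1 (k + j)) - unitW (sf k) (sm k) (W1 k)) Lc (cW * θ ^ k) δW)
    (hR : 0 < R) (hRK : R < δK) (hRS : R / 2 < δS) (hRW : R < δW) (hθ0 : 0 ≤ θ) (hθ1 : θ < 1) (μ ν : Fin 4) {N Cg : ℝ}
    (hstep : ∀ m : ℕ, 1 ≤ m →
      fPerfG Lc sf sm A G S Wt μ ν (m + 1) = fPerfG Lc sf sm A G S Wt μ ν m + fPerfG Lc sf sm A G S Wt μ ν 1)
    (hasym : ∀ m : ℕ, 1 ≤ m → |fPerfG Lc sf sm A G S Wt μ ν m - (m : ℝ) * stepBal N Lc| ≤ Cg)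
    {β : HBeta} {Cn : B12.Construction} (hgen : ForwardGenerated Cn β) (Sβ : B12Beta.OneLoopSplit β)
    (hβ : ∀ j, Sβ.β0 j = B12Beta.secondMoment (TbalOf Lc Js j) μ ν)
    {rr γ₀ : ℝ} (hγ₀ : 0 < γ₀) (hrem : RemainderConst Sβ γ₀ rr) (hr' : rr ≤ stepBal N Lc) (hcont : BetaContH γ₀ β) :
    EndpointExistence Cn :=
  endpointExistence_of_D1Drift hgen Sβ Js hβ
    (d1Drift_of_generic_step_law_bounded Js sf sm A G S Wt hsf hsm hT hA1 hG1 hS1 hW1 hA hAall hK hKall hS hSall hW hWall hR hRK hRS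
      hRW hθ0 hθ1 μ ν hstep hasym) hγ₀ hrem hr' hcont

end End

/-! ## §3 The DIRECT instance: ANY step jet data, closed form by `rfl` -/

section Self

variable {Lc : ℕ} [NeZero Lc] (Js : ℕ → JetData 3 Lc) (sf sm : ℕ → ℝ) (G : ℕ → ℕ → MKer (3 + 1) (Fib 3))
  (S : ℕ → ℕ → Fin (3 + 1) → (Fin (3 + 1) → ℤ) → MKer (3 + 1) (Fib 3))
  (Wt : ℕ → ℕ → Fin (3 + 1) → (Fin (3 + 1) → ℤ) → Fin (3 + 1) → (Fin (3 + 1) → ℤ) → MKer (3 + 1) (Fib 3))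
  {R C cK δK Cs cS δS Cw cW δW θ : ℝ}

/-- **ROAD «FP», THE END FOR ARBITRARY STEP JET DATA (bounded-defect form).**  For ANY `Js` (any dressing, any root) and ANY (j, m)-families
`(G, S, Wt)` whose `m = 1` members are `(KInvStep Lc j, (Js j).S, (Js j).W)`: Cauchy-currency rows on the unit-rescaled resolvents `D_j K_j D_j`
(EXACTLY lane G-an2-4's K-slot currency), on the jet data's OWN rescaled stencils and tables, (STEP) + (ASYMP) for `fPerfG … G G S Wt` ⊢
`D1Drift Lc Js N μ ν`.  No dressing lemma is used (`HessKerFourFamily.TbalOf_apply`). -/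
theorem d1Drift_of_self_step_law_bounded (hsf : ∀ j, sf j ≠ 0) (hsm : ∀ j, sm j ≠ 0)
    (hG1 : ∀ j, G j 1 = KInvStep (d := 3) Lc j) (hS1 : ∀ j, S j 1 = (Js j).S) (hW1 : ∀ j, Wt j 1 = (Js j).W)
    (hK : ∀ j, Decays (unitK (sf j) (sm j) (KInvStep (d := 3) Lc j)) C δK)
    (hKall : ∀ k j, Decays (unitK (sf (k + j)) (sm (k + j)) (KInvStep (d := 3) Lc (k + j)) -
      unitK (sf k) (sm k) (KInvStep (d := 3) Lc k)) (cK * θ ^ k) δK)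
    (hS : ∀ j, LocStencil (unitS (sf j) (sm j) (Js j).S) Cs δS)
    (hSall : ∀ k j, LocStencil (unitS (sf (k + j)) (sm (k + j)) (Js (k + j)).S - unitS (sf k) (sm k) (Js k).S) (cS * θ ^ k) δS)
    (hW : ∀ j, VertexFamily₂ (unitW (sf j) (sm j) (Js j).W) Lc Cw δW)
    (hWall : ∀ k j, VertexFamily₂ (unitW (sf (k + j)) (sm (k + j)) (Js (k + j)).W - unitW (sf k) (sm k) (Js k).W) Lc (cW * θ ^ k) δW)
    (hR : 0 < R) (hRK : R < δK) (hRS : R / 2 < δS) (hRW : R < δW) (hθ0 : 0 ≤ θ) (hθ1 : θ < 1) (μ ν : Fin 4) {N Cg : ℝ}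
    (hstep : ∀ m : ℕ, 1 ≤ m →
      fPerfG Lc sf sm G G S Wt μ ν (m + 1) = fPerfG Lc sf sm G G S Wt μ ν m + fPerfG Lc sf sm G G S Wt μ ν 1)
    (hasym : ∀ m : ℕ, 1 ≤ m → |fPerfG Lc sf sm G G S Wt μ ν m - (m : ℝ) * stepBal N Lc| ≤ Cg) :
    D1Drift Lc Js N μ ν :=
  d1Drift_of_generic_step_law_bounded Js sf sm G G S Wt (A1 := fun j => KInvStep (d := 3) Lc j) (G1 := fun j => KInvStep (d := 3) Lc j)
    (S1 := fun j => (Js j).S) (W1 := fun j => (Js j).W) hsf hsm (TbalOf_apply Js) hG1 hG1 hS1 hW1 hK hKall hK hKall hS hSall hW hWall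
    hR hRK hRS hRW hθ0 hθ1 μ ν hstep hasym

end Self

/-! ## §4 The BLOCK-MEAN ROOTED instance: `Js = dressBmAt hr ∘ Js⁰`, co-dressed resolvents, undressed jets -/

section BlockMean

variable {Lc : ℕ} [NeZero Lc] {r : Fin 4 → ℕ} (hr : r ∈ box 4 Lc) (Js0 : ℕ → JetData 3 Lc) (sf sm : ℕ → ℝ)
  (G : ℕ → ℕ → MKer (3 + 1) (Fib 3)) (S : ℕ → ℕ → Fin (3 + 1) → (Fin (3 + 1) → ℤ) → MKer (3 + 1) (Fib 3))
  (Wt : ℕ → ℕ → Fin (3 + 1) → (Fin (3 + 1) → ℤ) → Fin (3 + 1) → (Fin (3 + 1) → ℤ) → MKer (3 + 1) (Fib 3))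
  {R C cK δK Cs cS δS Cw cW δW θ : ℝ}

/-- **ROAD «FP», THE END FOR A BLOCK-MEAN ROOTED DRESSED FAMILY (bounded-defect form).**  For UNDRESSED step jets `Js⁰`, an in-block root `r`,
the dressed family `fun j ↦ dressBmAt hr (Js⁰ j)` (an2's `TbalOf_dressBmAt`: `G_j = coDressKBmAt (toSite r) Lc (KInvStep Lc j)`, undressed jets),
and ANY (j, m)-families `(G, S, Wt)` with `m = 1` members `(G_j, (Js⁰ j).S, (Js⁰ j).W)`: Cauchy-currency rows on `D_j G_j D_j` (asym1's
`HessKerCoDressedBmWall.exists_coDressedBm_unit_rows` derives them from the ENTRYWISE rows of G-an2-4), on the undressed rescaled stencils and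
tables, (STEP) + (ASYMP) ⊢ `D1Drift Lc (dressBmAt hr ∘ Js⁰) N μ ν`.  In THIS dressing every finite-`j` Ward / relative-inverse letter of the
tree is typed (leaf-01-g5's census, journal l.15863). -/
theorem d1Drift_dressBmAt_of_step_law_bounded (hsf : ∀ j, sf j ≠ 0) (hsm : ∀ j, sm j ≠ 0)
    (hG1 : ∀ j, G j 1 = coDressKBmAt (toSite r) Lc (KInvStep (d := 3) Lc j))
    (hS1 : ∀ j, S j 1 = (Js0 j).S) (hW1 : ∀ j, Wt j 1 = (Js0 j).W)
    (hK : ∀ j, Decays (unitK (sf j) (sm j) (coDressKBmAt (toSite r) Lc (KInvStep (d := 3) Lc j))) C δK)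
    (hKall : ∀ k j, Decays (unitK (sf (k + j)) (sm (k + j)) (coDressKBmAt (toSite r) Lc (KInvStep (d := 3) Lc (k + j))) -
      unitK (sf k) (sm k) (coDressKBmAt (toSite r) Lc (KInvStep (d := 3) Lc k))) (cK * θ ^ k) δK)
    (hS : ∀ j, LocStencil (unitS (sf j) (sm j) (Js0 j).S) Cs δS)
    (hSall : ∀ k j, LocStencil (unitS (sf (k + j)) (sm (k + j)) (Js0 (k + j)).S - unitS (sf k) (sm k) (Js0 k).S) (cS * θ ^ k) δS)
    (hW : ∀ j, VertexFamily₂ (unitW (sf j) (sm j) (Js0 j).W) Lc Cw δW)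
    (hWall : ∀ k j, VertexFamily₂ (unitW (sf (k + j)) (sm (k + j)) (Js0 (k + j)).W - unitW (sf k) (sm k) (Js0 k).W) Lc (cW * θ ^ k) δW)
    (hR : 0 < R) (hRK : R < δK) (hRS : R / 2 < δS) (hRW : R < δW) (hθ0 : 0 ≤ θ) (hθ1 : θ < 1) (μ ν : Fin 4) {N Cg : ℝ}
    (hstep : ∀ m : ℕ, 1 ≤ m →
      fPerfG Lc sf sm G G S Wt μ ν (m + 1) = fPerfG Lc sf sm G G S Wt μ ν m + fPerfG Lc sf sm G G S Wt μ ν 1)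
    (hasym : ∀ m : ℕ, 1 ≤ m → |fPerfG Lc sf sm G G S Wt μ ν m - (m : ℝ) * stepBal N Lc| ≤ Cg) :
    D1Drift Lc (fun j => dressBmAt hr (Js0 j)) N μ ν :=
  d1Drift_of_generic_step_law_bounded (fun j => dressBmAt hr (Js0 j)) sf sm G G S Wt
    (A1 := fun j => coDressKBmAt (toSite r) Lc (KInvStep (d := 3) Lc j)) (G1 := fun j => coDressKBmAt (toSite r) Lc (KInvStep (d := 3) Lc j))
    (S1 := fun j => (Js0 j).S) (W1 := fun j => (Js0 j).W) hsf hsm (TbalOf_dressBmAt hr Js0) hG1 hG1 hS1 hW1 hK hKall hK hKall hS hSall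
    hW hWall hR hRK hRS hRW hθ0 hθ1 μ ν hstep hasym

end BlockMean

end

end Summit.QuantumFields.BalabanUV.Beta.FP.RoadEndGeneric
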